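import Summits.QuantumAdvantage.QuantumAdvantage.Theorems.WhiteBoxWalkWbwThesisExtract
import Summits.QuantumAdvantage.QuantumAdvantage.Theorems.WhiteBoxWalkWbwThesisCanon
import Literature.Computability.Complexity.CodeFPStringKit

/-!
# Route `WhiteBoxWalk`, crux `WbwThesis` (stmt-QuantumAdvantage-2238), line `Sketch`: re-assembling the answer

`stub_assemble`: a polynomial-time string function `g` maps `⟨genPQ w, y⟩`, for ANY `y` beginning
with the code `factorCode (bigProd w)` of the prime factorisation of the product of the hard-block
semiprimes, to the answer `ansPQ w`.

THE FORMAT (`Extract.genPQ_eq_rawE`). With `n = nOf |w|`, `t = t(n)`, `x_j = blk n j w`: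
`genPQ w = rawE strE items`, `items = [pad n (fPQ x_0), …, pad n (fPQ x_{t-1}), sfx]`,
`pad n (fPQ x_j) = fPQ x_j ++ [1]` (`Extract.pad_fPQ`), `sfx = w ⇂ (n t)`; and
`y = factorCode N ++ junk = ⟨1ᵏ, rawE natE L ++ junk⟩` with `L = primeFactorsList N` (ascending,
`k = |L|`), because the pairing is self-delimiting in its first component (`factorCode_eq`). So the
input is the code `pairE (rawE strE) (pairE unE strE) (items, k, rawE natE L ++ junk)`.

THE PROGRAM (typed layer `CodeFP`, Arora–Barak §1.3), sub-namespace `Assemble`: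
* the parser (`parse_codeFP`): `k` reading steps `(s, acc) ↦ (sndF s, acc ++ [⟦fstF s⟧])` on
  `rawE natE L ++ junk` (a fold over the unary budget `1ᵏ`; the state never outgrows the input,
  `parse_inv`) collect exactly `L` (`parse_rawE`);
* the piece of an item `s` in context `L` (`piece_codeFP`): `body = dropLast (tail s)`; an easy item
  (`s[0] = 0`) yields `body` (`= x_j`); a hard item yields
  `encW m p ++ encW m (N / p) ++ 0^{n - 2m}` with `N = ⟦body⟧ = P_j Q_j`, `n = |body|`, `m = ⌊n/2⌋`
  and `p` the FIRST listed prime dividing `N` (`filter` + `headD`), which is `minFac N` because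
  `N ∣ bigProd w` and `L` is sorted (`headD_filter_dvd_eq_minFac`, `fdiv_blk`) — so the piece is
  exactly `invPQ n (fPQ x_j)` (`piece_pad_fPQ`);
* the program (`program_codeFP`): the pieces of the first `|items| - 1` items are concatenated
  (`map`, `strFlatten`), the last item (the suffix) is appended — this is `prePQ w`, of length
  `|w| ≤ |genPQ w|` (`stub_canon`) — and the result is zero-padded to the instance length `|genPQ w|`
  (`takeD`), giving `ansPQ w` (`assemble_eq`).
For `|w| < 64` (`t = 0`): `items = [w]`, `L = []`, and the output is `w` padded — again `ansPQ w`.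

References: S. Arora, B. Barak, *Computational Complexity* (2009), §1.3 (closure of polynomial time
under composition and polynomially bounded loops), §0.1 (self-delimiting codes); O. Goldreich,
*Foundations of Cryptography I* (2001), §2.3.1 (the direct-product format).
-/

noncomputable section

set_option linter.dupNamespace false -- D-0017: single-problem summit ⇒ `QuantumAdvantage.QuantumAdvantage` by design

namespace Summit.QuantumAdvantage.QuantumAdvantage.Theorems.WhiteBoxWalk

open Literature.Computability.Cryptography Literature.Computability.Complexity
open _root_.Computability Polynomial
open Literature.Computability.Complexity.CodeFP
open Literature.Computability.Complexity.Brick (fstF sndF fstF_boolPair sndF_boolPair fstF_mem_FP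
  sndF_mem_FP length_fstF_sndF_le)

namespace Assemble

/-! ### The parser -/

/-- The parser's state never outgrows the input: `2 |unread| + |code of the values read|` grows by
at most `2` per reading step `(s, acc) ↦ (sndF s, acc ++ [⟦fstF s⟧])`. [folklore] -/
theorem parse_inv : ∀ (l : List Unit) (st : List Bool × List ℕ),
    2 * (l.foldl (fun st _ => (sndF st.1, st.2 ++ [bitsToNat (fstF st.1)])) st).1.length +
        (rawE natE (l.foldl (fun st _ => (sndF st.1, st.2 ++ [bitsToNat (fstF st.1)])) st).2).length ≤
      2 * st.1.length + (rawE natE st.2).length + 2 * l.length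
  | [], st => by simp
  | u :: l, st => by
    rw [List.foldl_cons, List.length_cons]
    refine (parse_inv l _).trans ?_
    dsimp only
    have h1 := length_fstF_sndF_le st.1
    have h2 : (natE (bitsToNat (fstF st.1))).length ≤ (fstF st.1).length :=
      length_natE_le_of_lt (bitsToNat_lt _)
    rw [rawE_append, List.length_append, rawE_cons, rawE_nil, length_boolPair]
    simp only [List.length_nil]
    omega

/-- **The parser reads a self-delimited list followed by junk**: `|L|` reading steps on
`rawE natE L ++ t` collect exactly `L` (and leave `t`). [Arora–Barak 2009, §0.1] -/
theorem parse_rawE (t : List Bool) : ∀ (L acc : List ℕ),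
    (List.replicate L.length ()).foldl (fun st _ => (sndF st.1, st.2 ++ [bitsToNat (fstF st.1)]))
      (rawE natE L ++ t, acc) = (t, acc ++ L)
  | [], acc => by simp
  | a :: L, acc => by
    rw [List.length_cons, List.replicate_succ, List.foldl_cons]
    dsimp only
    have hba : boolPair (natE a) (rawE natE L) ++ t = boolPair (natE a) (rawE natE L ++ t) := by
      simp [boolPair, List.append_assoc]
    rw [rawE_cons, hba, sndF_boolPair, fstF_boolPair, bitsToNat_natE, parse_rawE t L,
      List.append_assoc, List.singleton_append]

/-- **The parser is polynomial time**: `(1ᵏ, s) ↦` the values read by `k` reading steps on `s`,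
a fold over the unary budget with the string as context (`CodeFP.foldl`, accumulator bound
`parse_inv`). [Arora–Barak 2009, §1.3] -/
theorem parse_codeFP : CodeFP (pairE unE strE) (rawE natE) (fun p =>
    ((List.replicate p.1 ()).foldl (fun st _ => (sndF st.1, st.2 ++ [bitsToNat (fstF st.1)])) (p.2, [])).2) := by
  have hF : CodeFP strE strE fstF := of_fn fstF fstF_mem_FP fun _ => rfl
  have hS : CodeFP strE strE sndF := of_fn sndF sndF_mem_FP fun _ => rfl
  have hst : CodeFP (pairE strE (pairE unitE (pairE strE (rawE natE)))) (pairE strE (rawE natE))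
      (fun t => t.2.2) := (snd _ _).snd'
  have hstep : CodeFP (pairE strE (pairE unitE (pairE strE (rawE natE)))) (pairE strE (rawE natE))
      (fun t => (sndF t.2.2.1, t.2.2.2 ++ [bitsToNat (fstF t.2.2.1)])) :=
    ((hS.comp hst.fst').pair ((rawAppend natE).comp (hst.snd'.pair ((rawSingleton natE).comp
      (strVal.comp (hF.comp hst.fst'))))) :)
  have h := foldl (σ := List Bool) (α := Unit) (β := List Bool × List ℕ) (eσ := strE) (eα := unitE)
    (eβ := pairE strE (rawE natE)) (step := fun _ _ st => (sndF st.1, st.2 ++ [bitsToNat (fstF st.1)]))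
    (init := fun s => (s, ([] : List ℕ))) hstep ((CodeFP.id strE).pair (const strE ([] : List ℕ)))
    (2 * X) (fun s l₁ l₂ => by
      have hi := parse_inv l₁ (s, [])
      have hl : l₁.length ≤ (rawE unitE (l₁ ++ l₂)).length :=
        le_trans (by simp) (length_le_length_rawE unitE (l₁ ++ l₂))
      simp only [pairE_apply, length_boolPair, rawE_nil, List.length_nil, eval_mul, eval_ofNat,
        eval_X] at hi ⊢
      dsimp only [strE, id] at hi ⊢
      omega)
  exact (((h.snd'.comp ((snd unE strE).pair (replicateUnit.comp (fst unE strE)))).congr fun p => rfl) :)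

/-! ### The first listed divisor is the least prime factor -/

/-- **In the sorted prime factorisation of a multiple `B` of `N ≠ 1`, the first entry dividing `N`
is `minFac N`.** [folklore] -/
theorem headD_filter_dvd_eq_minFac {B N : ℕ} (hB : B ≠ 0) (hNB : N ∣ B) (hN1 : N ≠ 1) :
    (B.primeFactorsList.filter (· ∣ N)).headD 0 = N.minFac := by
  have hmp : N.minFac.Prime := Nat.minFac_prime hN1
  have hmem : N.minFac ∈ B.primeFactorsList.filter (· ∣ N) :=
    List.mem_filter.2 ⟨(Nat.mem_primeFactorsList hB).2 ⟨hmp, (Nat.minFac_dvd N).trans hNB⟩,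
      decide_eq_true (Nat.minFac_dvd N)⟩
  have hsort : (B.primeFactorsList.filter (· ∣ N)).Pairwise (· ≤ ·) :=
    (List.sortedLE_iff_pairwise.1 (Nat.primeFactorsList_sorted B)).filter _
  obtain ⟨a, F, hF⟩ := List.exists_cons_of_ne_nil (List.ne_nil_of_mem hmem)
  rw [hF] at hmem hsort
  rw [hF, List.headD_cons]
  have ha : a ∈ B.primeFactorsList.filter (· ∣ N) := by rw [hF]; exact List.mem_cons_self
  obtain ⟨haL, haN⟩ := List.mem_filter.1 ha
  have hle : N.minFac ≤ a :=
    Nat.minFac_le_of_dvd (Nat.prime_of_mem_primeFactorsList haL).two_le (of_decide_eq_true haN)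
  rcases List.mem_cons.1 hmem with h | h
  · exact h.symm
  · exact le_antisymm ((List.pairwise_cons.1 hsort).1 _ h) hle

/-- For a hard block `x_j` (`j < t`), the first listed prime of `bigProd w` dividing `P_j Q_j` is
`minFac (P_j Q_j)`: `P_j Q_j ≠ 1` is one of the (nonzero) factors of the product. [folklore] -/
theorem fdiv_blk (w : List Bool) {j : ℕ} (hj : j < pqParams.T (pqParams.nOf w.length))
    (hx : isPrimePair (Yao.blk (pqParams.nOf w.length) j w) = true) :
    ((bigProd w).primeFactorsList.filter
        (· ∣ pOf (Yao.blk (pqParams.nOf w.length) j w) * qOf (Yao.blk (pqParams.nOf w.length) j w))).headD 0 =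
      (pOf (Yao.blk (pqParams.nOf w.length) j w) * qOf (Yao.blk (pqParams.nOf w.length) j w)).minFac := by
  set n := pqParams.nOf w.length
  obtain ⟨hP, hQ, -, -⟩ := (isPrimePair_eq_true_iff _).1 hx
  refine headD_filter_dvd_eq_minFac ?_ ?_ fun h => hP.ne_one (Nat.eq_one_of_mul_eq_one_right h)
  · -- every factor of the product is nonzero
    unfold bigProd
    refine List.prod_ne_zero fun h0 => ?_
    obtain ⟨i, -, hi⟩ := List.mem_map.1 h0
    by_cases hpp : isPrimePair (Yao.blk n i w) = true
    · rw [if_pos hpp] at hi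
      obtain ⟨hP', hQ', -, -⟩ := (isPrimePair_eq_true_iff _).1 hpp
      exact (Nat.mul_ne_zero hP'.ne_zero hQ'.ne_zero) hi
    · rw [if_neg hpp] at hi
      exact one_ne_zero hi
  · unfold bigProd
    refine List.dvd_prod (List.mem_map.2 ⟨j, List.mem_range.2 hj, ?_⟩)
    rw [if_pos hx]

/-! ### The piece of an item -/

/-- `takeD` is truncate-then-pad. [folklore] -/
theorem takeD_eq_take_append : ∀ (n : ℕ) (l : List Bool),
    l.takeD n false = l.take n ++ List.replicate (n - l.length) false
  | 0, l => by simp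
  | n + 1, [] => by simp [List.replicate_succ]
  | n + 1, b :: l => by simp [takeD_eq_take_append n l]

/-- The width-`m` numeral is a `takeD` of the binary numeral. [folklore] -/
theorem takeD_natE (m v : ℕ) : (natE v).takeD m false = encW m v := by
  rw [takeD_eq_take_append]; rfl

/-- **The piece of a kept item is the canonical preimage block.** For `s = pad |x| (fPQ x)`:
`body = dropLast (tail s)` is `x` (easy) or `encW |x| (P Q)` (hard), `s[0]` is the branch tag, and
on the hard branch `⟦body⟧ = P Q` (`Canon.bitsToNat_encW`); so, provided the first listed divisor of
`P Q` is `minFac (P Q)`, the piece is `invPQ |x| (fPQ x)`. [folklore] -/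
theorem piece_pad_fPQ (L : List ℕ) (x : List Bool)
    (hmin : isPrimePair x = true → (L.filter (· ∣ pOf x * qOf x)).headD 0 = (pOf x * qOf x).minFac) :
    (if (pqParams.pad x.length (fPQ x)).getD 0 false then
        encW ((pqParams.pad x.length (fPQ x)).tail.dropLast.length / 2)
            ((L.filter (· ∣ bitsToNat (pqParams.pad x.length (fPQ x)).tail.dropLast)).headD 0) ++
          encW ((pqParams.pad x.length (fPQ x)).tail.dropLast.length / 2)
            (bitsToNat (pqParams.pad x.length (fPQ x)).tail.dropLast /
              (L.filter (· ∣ bitsToNat (pqParams.pad x.length (fPQ x)).tail.dropLast)).headD 0) ++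
          List.replicate ((pqParams.pad x.length (fPQ x)).tail.dropLast.length -
            2 * ((pqParams.pad x.length (fPQ x)).tail.dropLast.length / 2)) false
      else (pqParams.pad x.length (fPQ x)).tail.dropLast) = invPQ x.length (fPQ x) := by
  rw [Extract.pad_fPQ]
  unfold fPQ
  cases hpp : isPrimePair x
  · -- easy item `0 · x · 1`
    simp [invPQ]
  · -- hard item `1 · encW |x| (P Q) · 1`
    have hlt : pOf x * qOf x < 2 ^ x.length := Extract.pOf_mul_qOf_lt x
    simp only [if_true, List.cons_append, List.getD_cons_zero, List.tail_cons, List.dropLast_concat,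
      length_encW, invPQ]
    rw [Canon.bitsToNat_encW hlt, hmin hpp]

/-- **The piece map is polynomial time** (context `L`, item `s`): bit access, `tail`/`dropLast`,
the value of a block, `filter` by a divisibility test and `headD`, division, fixed-width numerals
by `takeD`, a zero filler, a branch. [Arora–Barak 2009, §1.3] -/
theorem piece_codeFP : CodeFP (pairE (rawE natE) strE) strE (fun t =>
    if t.2.getD 0 false then
      encW (t.2.tail.dropLast.length / 2) ((t.1.filter (· ∣ bitsToNat t.2.tail.dropLast)).headD 0) ++
        encW (t.2.tail.dropLast.length / 2)
          (bitsToNat t.2.tail.dropLast / (t.1.filter (· ∣ bitsToNat t.2.tail.dropLast)).headD 0) ++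
        List.replicate (t.2.tail.dropLast.length - 2 * (t.2.tail.dropLast.length / 2)) false
    else t.2.tail.dropLast) := by
  -- the leaves
  have hbody : CodeFP strE strE (fun s => s.tail.dropLast) :=
    ((strTake.comp (((Extract.unSubConst 1).comp strLength).pair (CodeFP.id strE))).comp
      (strDrop.comp ((const strE 1).pair (CodeFP.id strE)))).congr fun s => by
        simp [List.dropLast_eq_take, List.drop_one]
  have hdvd : CodeFP (pairE natE natE) bitE (fun r => decide (r.2 ∣ r.1)) :=
    ((beq natE_injective).comp (natMod.pair (const _ 0))).congr fun r => by
      rw [Bool.eq_iff_iff, beq_iff_eq, decide_eq_true_iff, Nat.dvd_iff_mod_eq_zero]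
  have hfd : CodeFP (pairE (rawE natE) natE) natE (fun q => (q.1.filter (· ∣ q.2)).headD 0) :=
    ((rawHeadD natE (d := 0) natE_zero).comp ((filter hdvd).comp ((snd _ _).pair (fst _ _))) :)
  have hencW : CodeFP (pairE unE natE) strE (fun q => encW q.1 q.2) :=
    (takeD.comp ((fst _ _).pair (strOfNat.comp (snd _ _)))).congr fun q => takeD_natE q.1 q.2
  have hhalf : CodeFP unE unE (fun m => m / 2) :=
    (unOfNatMin.comp ((CodeFP.id unE).pair (natDiv.comp (natOfUn.pair (const unE 2))))).congr
      fun m => min_eq_left (Nat.div_le_self m 2)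
  have hfill : CodeFP unE strE (fun n => List.replicate (n - 2 * (n / 2)) false) :=
    (MachineA.falses_code.comp (MachineA.unSub.comp ((CodeFP.id unE).pair ((unMulConst 2).comp hhalf))) :)
  -- the hard piece on `(L, body)`
  have hhard : CodeFP (pairE (rawE natE) strE) strE (fun q =>
      encW (q.2.length / 2) ((q.1.filter (· ∣ bitsToNat q.2)).headD 0) ++
        encW (q.2.length / 2) (bitsToNat q.2 / (q.1.filter (· ∣ bitsToNat q.2)).headD 0) ++
        List.replicate (q.2.length - 2 * (q.2.length / 2)) false) := by
    have hN : CodeFP (pairE (rawE natE) strE) natE (fun q => bitsToNat q.2) := strVal.comp (snd _ _)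
    have hp : CodeFP (pairE (rawE natE) strE) natE (fun q => (q.1.filter (· ∣ bitsToNat q.2)).headD 0) :=
      (hfd.comp ((fst _ _).pair hN) :)
    have hm : CodeFP (pairE (rawE natE) strE) unE (fun q => q.2.length / 2) :=
      hhalf.comp (strLength.comp (snd _ _))
    exact (strAppend.comp ((strAppend.comp ((hencW.comp (hm.pair hp)).pair
      (hencW.comp (hm.pair (natDiv.comp (hN.pair hp)))))).pair
        (hfill.comp (strLength.comp (snd _ _)))) :)
  -- the branch
  exact ((strGetD.comp ((const _ 0).pair (snd _ _))).ite
    (hhard.comp ((fst _ _).pair (hbody.comp (snd _ _)))) (hbody.comp (snd _ _)) :)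

/-! ### The whole program -/

/-- **The re-assembly program is polynomial time**, for any polynomial-time piece map `pc` and
parser `parse`: parse the context; map the piece map over the first `|items| - 1` items and
concatenate; append the last item; pad to the length of the instance. [Arora–Barak 2009, §1.3] -/
theorem program_codeFP {pc : List ℕ × List Bool → List Bool} (hpc : CodeFP (pairE (rawE natE) strE) strE pc)
    {parse : ℕ × List Bool → List ℕ} (hparse : CodeFP (pairE unE strE) (rawE natE) parse) :
    CodeFP (pairE (rawE strE) (pairE unE strE)) strE (fun t =>
      List.takeD (rawE strE t.1).length
        ((List.map (fun s => pc (parse t.2, s)) (t.1.take (t.1.length - 1))).flatten ++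
          t.1.getD (t.1.length - 1) []) false) := by
  have hitems : CodeFP (pairE (rawE strE) (pairE unE strE)) (rawE strE) (fun t => t.1) := fst _ _
  have hfront : CodeFP (pairE (rawE strE) (pairE unE strE)) (rawE strE)
      (fun t => t.1.take (t.1.length - 1)) :=
    ((rawTakeUn strE).comp ((((Extract.unSubConst 1).comp (ulength strE)).comp hitems).pair hitems) :)
  have hlast : CodeFP (pairE (rawE strE) (pairE unE strE)) strE (fun t => t.1.getD (t.1.length - 1) []) :=
    ((rawGetD strE (d := []) rfl).comp (hitems.pair (natSub.comp (((natLength strE).comp hitems).pair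
      (const _ 1)))) :)
  have hraw : CodeFP (rawE strE) strE (fun l => rawE strE l) := (CodeFP.id (rawE strE)).recodeOut fun _ => rfl
  have hlen : CodeFP (pairE (rawE strE) (pairE unE strE)) unE (fun t => (rawE strE t.1).length) :=
    (strLength.comp (hraw.comp hitems) :)
  have hpieces : CodeFP (pairE (rawE strE) (pairE unE strE)) strE
      (fun t => (List.map (fun s => pc (parse t.2, s)) (t.1.take (t.1.length - 1))).flatten) :=
    (((strFlatten.comp ((map hpc).comp ((hparse.comp (snd _ _)).pair hfront))).congr fun t => rfl) :)
  exact (takeD.comp (hlen.pair (strAppend.comp (hpieces.pair hlast))) :)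

/-! ### The output is the answer -/

/-- Padding a short string by `takeD`. [folklore] -/
theorem takeD_of_length_le {n : ℕ} {l : List Bool} (h : l.length ≤ n) :
    l.takeD n false = l ++ List.replicate (n - l.length) false := by
  rw [takeD_eq_take_append, List.take_of_length_le h]

/-- **Assembly**: if the piece of every kept item is the canonical preimage block, then the
program's output on the items of `genPQ w` is `ansPQ w` (`prePQ w` is the concatenation of the
blocks and the suffix; it has length `|w| ≤ |genPQ w|`, `stub_canon`, so padding to `|genPQ w|`
appends `|genPQ w| - |w|` zeros). [folklore] -/
theorem assemble_eq (w : List Bool) (pc : List Bool → List Bool)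
    (hpc : ∀ j < pqParams.T (pqParams.nOf w.length),
      pc (pqParams.pad (pqParams.nOf w.length) (fPQ (Yao.blk (pqParams.nOf w.length) j w))) =
        invPQ (pqParams.nOf w.length) (fPQ (Yao.blk (pqParams.nOf w.length) j w)))
    (items : List (List Bool))
    (hitems : items = pqParams.comps (pqParams.nOf w.length) (pqParams.T (pqParams.nOf w.length)) w ++
      [w.drop (pqParams.nOf w.length * pqParams.T (pqParams.nOf w.length))]) :
    List.takeD (rawE strE items).length
      ((List.map pc (items.take (items.length - 1))).flatten ++ items.getD (items.length - 1) []) false =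
      ansPQ w := by
  set n := pqParams.nOf w.length with hn
  set T := pqParams.T n with hT
  have hgen : rawE strE items = genPQ w := by rw [hitems, Extract.genPQ_eq_rawE]
  have hlen : items.length - 1 = (pqParams.comps n T w).length := by
    rw [hitems, List.length_append, List.length_singleton, Nat.add_sub_cancel]
  rw [hgen, hlen, hitems, List.take_left' rfl, List.getD_eq_getElem?_getD, List.getElem?_concat_length,
    Option.getD_some]
  have hmap : List.map pc (pqParams.comps n T w) = (List.range T).map fun j => invPQ n (fPQ (Yao.blk n j w)) := by
    unfold Yao.Params.comps
    rw [List.map_map]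
    refine List.map_congr_left fun j hj => ?_
    rw [Function.comp_apply, pqParams_f]
    exact hpc j (List.mem_range.1 hj)
  have hpre : (List.map pc (pqParams.comps n T w)).flatten ++ w.drop (n * T) = prePQ w := by
    rw [hmap, prePQ, yaoPre, List.flatMap_def]
    rfl
  rw [hpre, takeD_of_length_le (by rw [(stub_canon w).2.1]; exact (stub_canon w).2.2), (stub_canon w).2.1]
  rfl

/-- The code of the factor list is the headed list code `⟨1^{|L|}, rawE natE L⟩`
(`CodeFP.listE_eq`). [folklore] -/
theorem factorCode_eq (N : ℕ) :
    factorCode N = boolPair (unE N.primeFactorsList.length) (rawE natE N.primeFactorsList) := by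
  show (encodingNatBool.listBool.encode) N.primeFactorsList = _
  rw [listE_eq]
  rfl

end Assemble

/-- **`stub_assemble`** (quantum side, post-processing): a polynomial-time string function which,
from the instance `genPQ w` and ANY string `y` beginning with the code of the prime factorisation
of `bigProd w`, re-assembles `ansPQ w` — the typed program `Assemble.program_codeFP` (with the piece
map `Assemble.piece_codeFP` and the parser `Assemble.parse_codeFP`) run on the code
`⟨items, ⟨1ᵏ, rawE natE L ++ junk⟩⟩` that `⟨genPQ w, y⟩` is. [Arora–Barak 2009, §1.3] -/
theorem stub_assemble : ∃ g : List Bool → List Bool, g ∈ FP ∧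
    ∀ w y, factorCode (bigProd w) <+: y → g (boolPair (genPQ w) y) = ansPQ w := by
  obtain ⟨g, hg, hspec⟩ := Assemble.program_codeFP Assemble.piece_codeFP Assemble.parse_codeFP
  refine ⟨g, hg, fun w y hy => ?_⟩
  obtain ⟨t, rfl⟩ := hy
  set n := pqParams.nOf w.length with hn
  set T := pqParams.T n with hT
  set items := pqParams.comps n T w ++ [w.drop (n * T)] with hitems
  set L := (bigProd w).primeFactorsList with hL
  have hblk : ∀ j, j < T → (Yao.blk n j w).length = n := fun j hj =>
    Yao.length_blk_of_le ((Nat.mul_le_mul_right n hj).trans (by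
      rw [Nat.mul_comm]; exact Yao.M_nOf_le pqParams w.length))
  have hbp : boolPair (unE L.length) (rawE natE L) ++ t = boolPair (unE L.length) (rawE natE L ++ t) := by
    simp [boolPair, List.append_assoc]
  have hin : boolPair (genPQ w) (factorCode (bigProd w) ++ t) =
      pairE (rawE strE) (pairE unE strE) (items, L.length, rawE natE L ++ t) := by
    rw [Extract.genPQ_eq_rawE, Assemble.factorCode_eq, hbp]
    rfl
  rw [hin, hspec]
  dsimp only
  rw [Assemble.parse_rawE, List.nil_append]
  exact Assemble.assemble_eq w _ (fun j hj => by
    have h := Assemble.piece_pad_fPQ L (Yao.blk n j w) (fun hx => Assemble.fdiv_blk w hj hx)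
    rwa [hblk j hj] at h) items hitems

end Summit.QuantumAdvantage.QuantumAdvantage.Theorems.WhiteBoxWalk

end
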